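import Summits.BirchSwinnertonDyer.BirchSwinnertonDyer.Theorems.GenusKolyvaginAtTwoPowDvdShaCardAtTwoPosTBottomRungClosureTransposition
import Summits.BirchSwinnertonDyer.BirchSwinnertonDyer.Theorems.GenusKolyvaginAtTwoPowDvdShaCardAtTwoPosTTranspositionPairChebotarev
import Summits.BirchSwinnertonDyer.BirchSwinnertonDyer.Theorems.GenusKolyvaginAtTwoPowDvdShaCardAtTwoRTBottomRungParity
import HarnessLib

/-!
# Route `GenusKolyvaginAtTwo`, crux L⁺_T `PowDvdShaCardAtTwoPosT` (stmt-BirchSwinnertonDyer-23379), road «E4⁺», socket hbot⁺ (LEAD R10″) —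
# LAYER 9: THE BOTTOM RUNG AT TRANSPOSITION-DEEP PRIMES, BOTH PARITIES, AND IN THE `addOrderOf c_L = 2^L` / `P(n) ∉ 2E(K[n])` CURRENCIES

Seat `bsd-line-gk2-p4` g24 (WIDTH-5 attach, cell `bsd-f1-sign2`), `--supports stmt-BirchSwinnertonDyer-23379 --as helper`.
THEOREMS ONLY (no definition, no named fact, no `sorry`).  BSD is NOT proved by any of this; L⁺_T / Q4_T are NOT claimed; nothing is closed.

WHAT.  gk2-p4 g20 / LEAD's `…RTBottomRungParity` §2–§4 VERBATIM except: `Δ < 0` and the non-square hypothesis deleted, every Gross condition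
`FrobEqFrobInfty W K (2^·) ·` replaced by gk2-p2 g22's transposition clause, the (V44)-socket in its regular form, and the one-class Čebotarev of
`exists_deep_mul_primitive` supplied by gk2-p5 g32's transposition-deep pair Čebotarev `exists_transposition_kolyvaginPrime_fullOrder_pair_gt` applied
to the pair `(X, X)`:
* `exists_deep_mul_primitive_transposition` (append a transposition-deep prime keeping primitivity),
* `exists_deep_primitive_of_gross_witness_transposition'` (no parity hypothesis; over layer 8),
* `exists_deep_primitive_of_gross_witness_pow_transposition` (`addOrderOf c_L = 2^L` currency),
* `exists_deep_notTwoDvd_of_gross_witness_transposition` (`P(n) ∉ 2E(K[n])` currency).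

HONEST FRAMING.  Ports; closes nothing; BSD is not proved.

References: [McCallumLMS1991] §3 Cor. 3.2, §4 Cor. 4.5, §5 Prop. 5.2 and its proof (p. 285); [Kolyvagin1991MathAnn] Thm. 2.2; [GrossLMS1991] §3 (3.1)–(3.3).
-/

set_option autoImplicit false
-- the Theorems namespace of this sub repeats the summit name by design (D-0017 nested layout)
set_option linter.dupNamespace false

noncomputable section

open scoped Classical

open Field NumberField IsDedekindDomain Function WeierstrassCurve Rat.HeightOneSpectrum
open Literature.NumberTheory.EllipticCurves
open Literature.NumberTheory.GaloisRepresentations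
open Literature.NumberTheory.GaloisCohomology
open Summit.BirchSwinnertonDyer.BirchSwinnertonDyer.Theses.GenusKolyvaginAtTwo (KolyvaginRelationAtTwo)
open Summit.BirchSwinnertonDyer.Rank1Residual (X11b.KolyvaginAssembly.discr_lt_neg_four JET.exists_compatible_data_of_grossCM)
open Summit.BirchSwinnertonDyer.BirchSwinnertonDyer.Theorems.GenusExact.VisiblePairAtTwo
  (natCast_mem_primesEquiv_symm natGenerator_eq_of_natCast_prime_mem natCast_prime_mem_iff_eq exists_natCast_mem
    torsionBy_two_eq_bot_of_surj torsionH1OfDvd_mem_torsionLocalKer)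

namespace Summit.BirchSwinnertonDyer.BirchSwinnertonDyer.Theorems.GenusExact.RelaxedCount

variable (W : WeierstrassCurve ℚ) [W.IsElliptic] [W.IsGloballyMinimal] [NeZero (W.conductorNorm ℤ)]
  {K : Type} [Field K] [NumberField K]

/-- **Append a deep prime keeping primitivity.**  Frame of L_T with Q2 and (NPh_L^{2N}) (`L ≥ 2`); `n` a square-free product of level-4
Gross–Kolyvagin primes with a datum `e`, `addOrderOf c₂(e) = 4`.  THEN there are a Zhang–Kolyvagin prime `ℓ ∤ n` of index `≥ L` with
`Frob = Frob_∞` on `K(E[2^L])` and a datum `e′` at `nℓ` with `addOrderOf c₂(e′) = 4`. [cite: McCallumLMS1991, §5 p. 285; §4 Cor. 4.5; §3 Cor. 3.2] -/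
theorem exists_deep_mul_primitive_transposition (hQ2 : KolyvaginRelationAtTwo) (hcm : ¬ W.HasCM) (hT : Odd W.tamagawaProduct)
    (hρ : ∀ m : ℕ, W.HasSurjectiveModNGaloisRep (2 ^ m : ℕ))
    (hK : IsImaginaryQuadratic K) (hodd : Odd (NumberField.discr K)) (h3 : NumberField.discr K ≠ -3)
    (hHe : SatisfiesHeegnerHypothesis (W.conductorNorm ℤ) K)
    (c : K ≃ₐ[ℚ] K) (hc : c ≠ 1)
    (Dt : ModularForms.ModularParametrizationData W (W.conductorNorm ℤ)) (β : ℤ) (ι : K →+* ℂ) {L : ℕ} (hL2 : 2 ≤ L)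
    (hNPh : ∀ z : galH1Torsion (W.baseChange K) ((2 ^ L : ℕ) : ℤ),
      (∀ ρ' ∈ torsionFixing (W.baseChange K) ((2 ^ L : ℕ) : ℤ), h1Eval (W.baseChange K) ((2 ^ L : ℕ) : ℤ) z ρ' = 0) →
      (∀ w : HeightOneSpectrum (𝓞 K), ((2 * W.conductorNorm ℤ : ℕ) : 𝓞 K) ∈ w.asIdeal →
        z ∈ selmerLocalKer (W.baseChange K) (w.adicCompletion K) ((2 ^ L : ℕ) : ℤ)) → z = 0)
    {n : ℕ} (hn : Squarefree n)
    (hnK : ∀ q ∈ n.primeFactors, Zhang2014.IsKolyvaginPrime (W.conductorNorm ℤ) W K 2 q ∧ 2 ≤ Zhang2014.kolyvaginIndex W 2 q)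
    (e : KolyvaginHeegnerData Dt β ι n) (he : addOrderOf (e.kolyvaginClass Nat.prime_two 2) = 2 ^ 2) :
    ∃ (ℓ : ℕ) (e' : KolyvaginHeegnerData Dt β ι (n * ℓ)), ℓ.Prime ∧ ℓ ∉ n.primeFactors ∧
      Zhang2014.IsKolyvaginPrime (W.conductorNorm ℤ) W K 2 ℓ ∧ L ≤ Zhang2014.kolyvaginIndex W 2 ℓ ∧
      (∃ (v : HeightOneSpectrum (𝓞 ℚ)) (𝔓 : Ideal (absIntegers (𝓞 ℚ) ℚ)) (h : absoluteGaloisGroup ℚ),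
        (ℓ : 𝓞 ℚ) ∈ v.asIdeal ∧ 𝔓 ∈ v.primesAbove ∧ IsArithFrobAt (𝓞 ℚ) h 𝔓 ∧ ∃ u : geomTorsion W 2, h • u ≠ u) ∧
      addOrderOf (e'.kolyvaginClass Nat.prime_two 2) = 2 ^ 2 := by
  haveI : Fact (Nat.Prime 2) := ⟨Nat.prime_two⟩
  have hn0 : n ≠ 0 := hn.ne_zero
  have h2K : Module.finrank ℚ K = 2 := hK.1
  have h4 : NumberField.discr K ≠ -4 := fun h ↦ by
    rw [h] at hodd
    exact (Int.not_even_iff_odd.mpr hodd) ⟨-2, by norm_num⟩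
  have hD : NumberField.discr K < -4 := X11b.KolyvaginAssembly.discr_lt_neg_four hK ⟨h3, h4⟩
  have hρ2 : W.HasSurjectiveModNGaloisRep 2 := by simpa using hρ 1
  have hsurj1 : W.HasSurjectiveModNGaloisRep ((2 : ℤ) ^ 1) := by exact_mod_cast hρ 1
  have hL1 : 1 ≤ L := by omega
  have h12 : (1 : ℕ) ≤ 2 := by norm_num
  have h4L : ((2 ^ 2 : ℕ) : ℤ) ∣ ((2 ^ L : ℕ) : ℤ) := by
    obtain ⟨k, hk⟩ := Nat.exists_eq_add_of_le hL2
    exact ⟨((2 ^ k : ℕ) : ℤ), by rw [hk, pow_add]; push_cast; ring⟩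
  -- `ι : H¹(K, E[4]) → H¹(K, E[2^L])` is injective
  have hbotK : AddSubgroup.torsionBy (W.baseChange K).toAffine.Point ((2 : ℕ) : ℤ) = ⊥ := by
    rw [eq_bot_iff]
    intro P hP
    rw [AddSubgroup.mem_bot]
    have hP' : 2 • P = 0 := by
      have h := (mem_torsionBy_iff.mp hP : ((2 : ℕ) : ℤ) • P = 0)
      rwa [natCast_zsmul] at h
    exact forall_two_nsmul_baseChange_of_hasSurjectiveModNGaloisRep_two_of_isImaginaryQuadratic W hρ2 K hK P hP'
  have hιinj : Injective (torsionH1OfDvd (W.baseChange K) h4L) :=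
    Summit.BirchSwinnertonDyer.BirchSwinnertonDyer.Theorems.GenusExact.VisiblePairAtTwo.torsionH1OfDvd_pow_injective
      (W.baseChange K) (p := 2) hbotK h4L
  set cK := e.kolyvaginClass Nat.prime_two 2 with hcK_def
  set X := torsionH1OfDvd (W.baseChange K) h4L cK with hX_def
  have hXord : addOrderOf X = 2 ^ 2 := by rw [hX_def, addOrderOf_injective _ hιinj, he]
  have hX0 : X ≠ 0 := PlusDescent.ne_zero_of_addOrderOf_eq_two_pow (by norm_num) hXord
  -- sign of `X`
  obtain ⟨hsgn, hτ⟩ := KolyvaginClassSign.sign_conjAct_kolyvaginClass_two hK h3 h4 hodd hHe hsurj1 c hc Dt β ι hn h12 hnK e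
  have hτX : conjAct W c ((2 ^ L : ℕ) : ℤ) X = (-W.rootNumber * (-1) ^ n.primeFactors.card) • X := by
    rw [hX_def, conjAct_torsionH1OfDvd, hτ, map_zsmul]
  -- `X` is Selmer at the places over `2N`
  have hsel2N : ∀ w : HeightOneSpectrum (𝓞 K), ((2 * W.conductorNorm ℤ : ℕ) : 𝓞 K) ∈ w.asIdeal →
      X ∈ selmerLocalKer (W.baseChange K) (w.adicCompletion K) ((2 ^ L : ℕ) : ℤ) := by
    intro w hw
    refine (torsionH1OfDvd_mem_selmerLocalKer_iff_mem (W.baseChange K) h4L (w.adicCompletion K) cK).mpr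
      (RankOneAtTwoOneDoor.kolyvaginClass_two_mem_selmerLocalKer_of_odd_tamagawaProduct W hρ hT K hK h3 h4 hHe Dt β ι 2 hn hnK e w
        (natCast_notMem_of_forall_primeFactors (K := K) hn w fun q hq hqw ↦ ?_))
    -- a prime `q ∣ n` in `w` together with `2N ∈ w`: `q ∣ 2N`, impossible
    have hqp : q.Prime := Nat.prime_of_mem_primeFactors hq
    have hunder : ∀ m : ℕ, (m : 𝓞 K) ∈ w.asIdeal → (m : 𝓞 ℚ) ∈ (w.under (𝓞 ℚ)).asIdeal := fun m hm ↦ by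
      change (m : 𝓞 ℚ) ∈ w.asIdeal.under (𝓞 ℚ)
      rw [Ideal.under_def, Ideal.mem_comap, map_natCast]
      exact hm
    have hgen : natGenerator (w.under (𝓞 ℚ)) = q := natGenerator_eq_of_natCast_prime_mem hqp (hunder q hqw)
    have hdvd := (Rat.natCast_mem_asIdeal_iff (w.under (𝓞 ℚ))).mp (hunder _ hw)
    rw [hgen] at hdvd
    rcases (Nat.Prime.dvd_mul hqp).mp hdvd with h2 | hN
    · exact (hnK q hq).1.2.2.2.1 ((Nat.prime_dvd_prime_iff_eq hqp Nat.prime_two).mp h2)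
    · exact (hnK q hq).1.2.1 hN
  -- Q5R's `hres` for the singleton, from (NPh_L^{2N})
  have hres : ∀ a : Fin 1 → ℤ, (∀ ρ' ∈ torsionFixing (W.baseChange K) ((2 ^ L : ℕ) : ℤ),
      h1Eval (W.baseChange K) ((2 ^ L : ℕ) : ℤ) (∑ i, a i • (![X] : Fin 1 → _) i) ρ' = 0) → ∑ i, a i • (![X] : Fin 1 → _) i = 0 := by
    intro a ha
    refine hNPh _ ha fun w hw ↦ ?_
    simp only [Fin.sum_univ_one, Fin.isValue, Matrix.cons_val_zero]
    exact AddSubgroup.zsmul_mem _ (hsel2N w hw) _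
  -- the separation hypothesis for the pair `(X, X)` (gk2-p5 g32's transposition-deep pair Čebotarev, used on a single class)
  have hres2 : ∀ a b : ℤ, (∀ ρ' ∈ torsionFixing (W.baseChange K) ((2 ^ L : ℕ) : ℤ),
      h1Eval (W.baseChange K) ((2 ^ L : ℕ) : ℤ) (a • X + b • X) ρ' = 0) → a • X + b • X = 0 := by
    intro a b hab
    have h := hres ![a + b] (fun ρ' hρ' ↦ by
      simp only [Fin.sum_univ_one, Fin.isValue, Matrix.cons_val_zero, add_zsmul]
      exact hab ρ' hρ')
    simpa only [Fin.sum_univ_one, Fin.isValue, Matrix.cons_val_zero, add_zsmul] using h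
  obtain ⟨ℓ, hℓb, hKol, hidx, hFrob, hloc2⟩ :=
    PlusDescent.exists_transposition_kolyvaginPrime_fullOrder_pair_gt W K hK hodd hHe hρ hc hL1 X X (m := 2) (κ := 2) (by norm_num)
      (by norm_num) hXord hXord hsgn hsgn hτX hτX hres2 (n.primeFactors.sup id + n)
  have hℓn : ℓ ∉ n.primeFactors := fun h ↦ by
    have : ℓ ≤ n.primeFactors.sup id := Finset.le_sup (f := id) h
    omega
  have hℓp : ℓ.Prime := hKol.1
  have hℓdvd : ¬ ℓ ∣ n := fun h ↦ hℓn (Nat.mem_primeFactors.mpr ⟨hℓp, h, hn0⟩)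
  have hsq : Squarefree (n * ℓ) :=
    (Nat.squarefree_mul ((Nat.Prime.coprime_iff_not_dvd hℓp).mpr hℓdvd).symm).mpr ⟨hn, hℓp.squarefree⟩
  have hall : ∀ q ∈ (n * ℓ).primeFactors, Zhang2014.IsKolyvaginPrime (W.conductorNorm ℤ) W K 2 q ∧ 2 ≤ Zhang2014.kolyvaginIndex W 2 q := by
    intro q hq
    rw [Nat.primeFactors_mul hn0 hℓp.ne_zero, Finset.mem_union] at hq
    rcases hq with hq | hq
    · exact hnK q hq
    · rw [hℓp.primeFactors, Finset.mem_singleton] at hq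
      subst hq
      exact ⟨hKol, hL2.trans hidx⟩
  -- a compatible datum at `nℓ`
  obtain ⟨dℓ, hdℓ⟩ := JET.exists_compatible_data_of_grossCM
    (phi_heegnerPointOfConductor_mem_range_map_ringClassField_holds (W.conductorNorm ℤ) W K) hK hD hHe 2 Dt β ι hn
    (fun q hq ↦ (hnK q hq).1) e
  obtain ⟨hσc, hS, hS', hemb⟩ := hdℓ ℓ hKol hℓn
  set e' := dℓ ℓ hKol hℓn with he'_def
  obtain ⟨v, hv⟩ := exists_natCast_mem (K := K) hℓp
  -- `2•X ∉ tors_v`, hence `2•cK ∉ tors_v` (ι preserves the strict local kernel)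
  have hX2 : ¬ ((2 ^ 1 : ℕ) : ℤ) • cK ∈ (W.baseChange K).torsionLocalKer (v.adicCompletion K) ((2 ^ 2 : ℕ) : ℤ) := by
    intro h
    have h' := torsionH1OfDvd_mem_torsionLocalKer (W.baseChange K) (v.adicCompletion K) h4L h
    rw [map_zsmul] at h'
    have := ((hloc2 v hv).1 1).mp h'
    omega
  -- Q2 at `v`: `2•c₂(e′) ∉ tors_v`, so `c₂(e′)` has order `4`
  have hQ := hQ2 W hcm K hK h3 h4 hHe hρ Dt β ι 2 h12 n ℓ hsq hℓp hℓdvd hall e e' hσc hS hS' hemb v hv 1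
  have he'2 : ((2 ^ 1 : ℕ) : ℤ) • e'.kolyvaginClass Nat.prime_two 2 ≠ 0 := fun h0 ↦
    hX2 (hQ.2.mp (by rw [h0]; exact AddSubgroup.zero_mem _))
  refine ⟨ℓ, e', hℓp, hℓn, hKol, hidx, hFrob, addOrderOf_eq_prime_pow (n := 1) ?_ ?_⟩
  · intro h
    apply he'2
    rw [natCast_zsmul]
    exact h
  · have h : (((2 ^ 2 : ℕ) : ℤ)) • e'.kolyvaginClass Nat.prime_two 2 = 0 := zsmul_discreteH1_torsion _ _
    rw [natCast_zsmul] at h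
    exact h

/-- **THE BOTTOM RUNG, no parity hypothesis.**  As `exists_deep_primitive_of_gross_witness`, without the parity of `ω(n₀)`: the all-deep primitive
product has `ω(n) ∈ {ω(n₀), ω(n₀)+1}`. [cite: McCallumLMS1991, §5 proof of Prop. 5.2, p. 285] [cite: Kolyvagin1991MathAnn, Thm. 2.2] -/
theorem exists_deep_primitive_of_gross_witness_transposition' (hQ2 : KolyvaginRelationAtTwo) (hcm : ¬ W.HasCM)
    (hT : Odd W.tamagawaProduct) (hρ : ∀ m : ℕ, W.HasSurjectiveModNGaloisRep (2 ^ m : ℕ))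
    (hK : IsImaginaryQuadratic K) (hodd : Odd (NumberField.discr K)) (h3 : NumberField.discr K ≠ -3)
    (hHe : SatisfiesHeegnerHypothesis (W.conductorNorm ℤ) K)
    (Dt : ModularForms.ModularParametrizationData W (W.conductorNorm ℤ)) (β : ℤ) (ι : K →+* ℂ) {L : ℕ} (hL2 : 2 ≤ L)
    (hNPh : ∀ z : galH1Torsion (W.baseChange K) ((2 ^ L : ℕ) : ℤ),
      (∀ ρ' ∈ torsionFixing (W.baseChange K) ((2 ^ L : ℕ) : ℤ), h1Eval (W.baseChange K) ((2 ^ L : ℕ) : ℤ) z ρ' = 0) →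
      (∀ w : HeightOneSpectrum (𝓞 K), ((2 * W.conductorNorm ℤ : ℕ) : 𝓞 K) ∈ w.asIdeal →
        z ∈ selmerLocalKer (W.baseChange K) (w.adicCompletion K) ((2 ^ L : ℕ) : ℤ)) → z = 0)
    (hTr : ∀ (n' : ℕ) (d' : KolyvaginHeegnerData Dt β ι n') (Z : galoisCohomology (W.torsionGaloisModule ((2 ^ 2 : ℕ) : ℤ)) 1),
      Squarefree n' →
      (∀ q ∈ n'.primeFactors, Zhang2014.IsKolyvaginPrime (W.conductorNorm ℤ) W K 2 q ∧ 2 ≤ Zhang2014.kolyvaginIndex W 2 q ∧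
        (∃ (v : HeightOneSpectrum (𝓞 ℚ)) (𝔓 : Ideal (absIntegers (𝓞 ℚ) ℚ)) (h : absoluteGaloisGroup ℚ),
          (q : 𝓞 ℚ) ∈ v.asIdeal ∧ 𝔓 ∈ v.primesAbove ∧ IsArithFrobAt (𝓞 ℚ) h 𝔓 ∧ ∃ u : geomTorsion W 2, h • u ≠ u)) →
      resTorsion W K ((2 ^ 2 : ℕ) : ℤ) Z = d'.kolyvaginClass Nat.prime_two 2 →
      ∀ (v : HeightOneSpectrum (𝓞 ℚ)) (ℓ : ℕ), ℓ ∈ n'.primeFactors → (ℓ : 𝓞 ℚ) ∈ v.asIdeal →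
        L ≤ Zhang2014.kolyvaginIndex W 2 ℓ →
        ∀ 𝔓 ∈ v.primesAbove, ∀ F : absoluteGaloisGroup ℚ, IsArithFrobAt (𝓞 ℚ) F 𝔓 →
          ∃ P₁ : geomTorsion W ((2 ^ 2 : ℕ) : ℤ), h1Eval W _ ((2 : ℕ) • Z) F = F • P₁ - P₁)
    {n₀ : ℕ} (hn₀ : Squarefree n₀)
    (hn₀K : ∀ q ∈ n₀.primeFactors, Zhang2014.IsKolyvaginPrime (W.conductorNorm ℤ) W K 2 q ∧ 2 ≤ Zhang2014.kolyvaginIndex W 2 q ∧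
      (∃ (v : HeightOneSpectrum (𝓞 ℚ)) (𝔓 : Ideal (absIntegers (𝓞 ℚ) ℚ)) (h : absoluteGaloisGroup ℚ),
        (q : 𝓞 ℚ) ∈ v.asIdeal ∧ 𝔓 ∈ v.primesAbove ∧ IsArithFrobAt (𝓞 ℚ) h 𝔓 ∧ ∃ u : geomTorsion W 2, h • u ≠ u))
    (e₀ : KolyvaginHeegnerData Dt β ι n₀) (he₀ : addOrderOf (e₀.kolyvaginClass Nat.prime_two 2) = 2 ^ 2) :
    ∃ (n : ℕ) (e : KolyvaginHeegnerData Dt β ι n), Squarefree n ∧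
      (n.primeFactors.card = n₀.primeFactors.card ∨ n.primeFactors.card = n₀.primeFactors.card + 1) ∧
      (∀ q ∈ n.primeFactors, Zhang2014.IsKolyvaginPrime (W.conductorNorm ℤ) W K 2 q ∧ L ≤ Zhang2014.kolyvaginIndex W 2 q ∧
        (∃ (v : HeightOneSpectrum (𝓞 ℚ)) (𝔓 : Ideal (absIntegers (𝓞 ℚ) ℚ)) (h : absoluteGaloisGroup ℚ),
          (q : 𝓞 ℚ) ∈ v.asIdeal ∧ 𝔓 ∈ v.primesAbove ∧ IsArithFrobAt (𝓞 ℚ) h 𝔓 ∧ ∃ u : geomTorsion W 2, h • u ≠ u)) ∧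
      addOrderOf (e.kolyvaginClass Nat.prime_two 2) = 2 ^ 2 := by
  have h2K : Module.finrank ℚ K = 2 := hK.1
  -- the sign `−w(E)(−1)^{ω+1}` is `±1`
  have hw : W.rootNumber = 1 ∨ W.rootNumber = -1 := W.rootNumber_eq_one_or
  by_cases hpar : -W.rootNumber * (-1) ^ (n₀.primeFactors.card + 1) = 1
  · obtain ⟨n, e, hn, hcard, hK', he⟩ := exists_deep_primitive_of_gross_witness_transposition W hQ2 hcm hT hρ hK hodd h3 hHe Dt β ι hL2 hNPh hTr
      hn₀ hn₀K e₀ he₀ hpar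
    exact ⟨n, e, hn, Or.inl hcard, hK', he⟩
  · -- append one deep prime to flip the parity
    obtain ⟨τ, -, hτ, -⟩ := PlusDescent.exists_gal_ne_one_sqrt_discr (K := K) h2K
    obtain ⟨ℓ, e₁, hℓp, hℓn, hKol, hidx, hFrob, he₁⟩ := exists_deep_mul_primitive_transposition W hQ2 hcm hT hρ hK hodd h3 hHe τ hτ Dt β ι hL2
      hNPh hn₀ (fun q hq ↦ ⟨(hn₀K q hq).1, (hn₀K q hq).2.1⟩) e₀ he₀
    have hn0 : n₀ ≠ 0 := hn₀.ne_zero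
    have hℓdvd : ¬ ℓ ∣ n₀ := fun h ↦ hℓn (Nat.mem_primeFactors.mpr ⟨hℓp, h, hn0⟩)
    have hsq : Squarefree (n₀ * ℓ) :=
      (Nat.squarefree_mul ((Nat.Prime.coprime_iff_not_dvd hℓp).mpr hℓdvd).symm).mpr ⟨hn₀, hℓp.squarefree⟩
    have hpf : (n₀ * ℓ).primeFactors = insert ℓ n₀.primeFactors := by
      rw [Nat.primeFactors_mul hn0 hℓp.ne_zero, hℓp.primeFactors, Finset.union_comm]; rfl
    have hcard : (n₀ * ℓ).primeFactors.card = n₀.primeFactors.card + 1 := by rw [hpf, Finset.card_insert_of_notMem hℓn]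
    have hK' : ∀ q ∈ (n₀ * ℓ).primeFactors, Zhang2014.IsKolyvaginPrime (W.conductorNorm ℤ) W K 2 q ∧ 2 ≤ Zhang2014.kolyvaginIndex W 2 q ∧
        (∃ (v : HeightOneSpectrum (𝓞 ℚ)) (𝔓 : Ideal (absIntegers (𝓞 ℚ) ℚ)) (h : absoluteGaloisGroup ℚ),
          (q : 𝓞 ℚ) ∈ v.asIdeal ∧ 𝔓 ∈ v.primesAbove ∧ IsArithFrobAt (𝓞 ℚ) h 𝔓 ∧ ∃ u : geomTorsion W 2, h • u ≠ u) := by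
      intro q hq
      rw [hpf, Finset.mem_insert] at hq
      rcases hq with rfl | hq
      · exact ⟨hKol, hL2.trans hidx, hFrob⟩
      · exact hn₀K q hq
    have hpm : -W.rootNumber * (-1) ^ (n₀.primeFactors.card + 1) = 1 ∨
        -W.rootNumber * (-1) ^ (n₀.primeFactors.card + 1) = -1 := by
      rcases hw with h | h <;> rcases neg_one_pow_eq_or ℤ (n₀.primeFactors.card + 1) with h1 | h1 <;> rw [h, h1] <;> norm_num
    have hm1 : -W.rootNumber * (-1) ^ (n₀.primeFactors.card + 1) = -1 := hpm.resolve_left hpar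
    have hpar' : -W.rootNumber * (-1) ^ ((n₀ * ℓ).primeFactors.card + 1) = 1 := by
      rw [hcard, pow_succ, ← mul_assoc, hm1]; norm_num
    obtain ⟨n, e, hn, hcardn, hKn, he⟩ := exists_deep_primitive_of_gross_witness_transposition W hQ2 hcm hT hρ hK hodd h3 hHe Dt β ι hL2 hNPh hTr
      hsq hK' e₁ he₁ hpar'
    exact ⟨n, e, hn, Or.inr (by rw [hcardn, hcard]), hKn, he⟩

/-- **THE BOTTOM RUNG in the socket currency of `exists_kolyvaginMinima`** (`addOrderOf c_L = 2^L` on an all-deep product, EITHER witness parity).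
[cite: McCallumLMS1991, §5 proof of Prop. 5.2, p. 285] [cite: Kolyvagin1991MathAnn, Thm. 2.2] -/
theorem exists_deep_primitive_of_gross_witness_pow_transposition (hQ2 : KolyvaginRelationAtTwo) (hcm : ¬ W.HasCM)
    (hT : Odd W.tamagawaProduct) (hρ : ∀ m : ℕ, W.HasSurjectiveModNGaloisRep (2 ^ m : ℕ))
    (hK : IsImaginaryQuadratic K) (hodd : Odd (NumberField.discr K)) (h3 : NumberField.discr K ≠ -3)
    (hHe : SatisfiesHeegnerHypothesis (W.conductorNorm ℤ) K)
    (Dt : ModularForms.ModularParametrizationData W (W.conductorNorm ℤ)) (β : ℤ) (ι : K →+* ℂ) {L : ℕ} (hL2 : 2 ≤ L)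
    (hNPh : ∀ z : galH1Torsion (W.baseChange K) ((2 ^ L : ℕ) : ℤ),
      (∀ ρ' ∈ torsionFixing (W.baseChange K) ((2 ^ L : ℕ) : ℤ), h1Eval (W.baseChange K) ((2 ^ L : ℕ) : ℤ) z ρ' = 0) →
      (∀ w : HeightOneSpectrum (𝓞 K), ((2 * W.conductorNorm ℤ : ℕ) : 𝓞 K) ∈ w.asIdeal →
        z ∈ selmerLocalKer (W.baseChange K) (w.adicCompletion K) ((2 ^ L : ℕ) : ℤ)) → z = 0)
    (hTr : ∀ (n' : ℕ) (d' : KolyvaginHeegnerData Dt β ι n') (Z : galoisCohomology (W.torsionGaloisModule ((2 ^ 2 : ℕ) : ℤ)) 1),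
      Squarefree n' →
      (∀ q ∈ n'.primeFactors, Zhang2014.IsKolyvaginPrime (W.conductorNorm ℤ) W K 2 q ∧ 2 ≤ Zhang2014.kolyvaginIndex W 2 q ∧
        (∃ (v : HeightOneSpectrum (𝓞 ℚ)) (𝔓 : Ideal (absIntegers (𝓞 ℚ) ℚ)) (h : absoluteGaloisGroup ℚ),
          (q : 𝓞 ℚ) ∈ v.asIdeal ∧ 𝔓 ∈ v.primesAbove ∧ IsArithFrobAt (𝓞 ℚ) h 𝔓 ∧ ∃ u : geomTorsion W 2, h • u ≠ u)) →
      resTorsion W K ((2 ^ 2 : ℕ) : ℤ) Z = d'.kolyvaginClass Nat.prime_two 2 →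
      ∀ (v : HeightOneSpectrum (𝓞 ℚ)) (ℓ : ℕ), ℓ ∈ n'.primeFactors → (ℓ : 𝓞 ℚ) ∈ v.asIdeal →
        L ≤ Zhang2014.kolyvaginIndex W 2 ℓ →
        ∀ 𝔓 ∈ v.primesAbove, ∀ F : absoluteGaloisGroup ℚ, IsArithFrobAt (𝓞 ℚ) F 𝔓 →
          ∃ P₁ : geomTorsion W ((2 ^ 2 : ℕ) : ℤ), h1Eval W _ ((2 : ℕ) • Z) F = F • P₁ - P₁)
    {n₀ : ℕ} (hn₀ : Squarefree n₀)
    (hn₀K : ∀ q ∈ n₀.primeFactors, Zhang2014.IsKolyvaginPrime (W.conductorNorm ℤ) W K 2 q ∧ 2 ≤ Zhang2014.kolyvaginIndex W 2 q ∧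
      (∃ (v : HeightOneSpectrum (𝓞 ℚ)) (𝔓 : Ideal (absIntegers (𝓞 ℚ) ℚ)) (h : absoluteGaloisGroup ℚ),
        (q : 𝓞 ℚ) ∈ v.asIdeal ∧ 𝔓 ∈ v.primesAbove ∧ IsArithFrobAt (𝓞 ℚ) h 𝔓 ∧ ∃ u : geomTorsion W 2, h • u ≠ u))
    (e₀ : KolyvaginHeegnerData Dt β ι n₀) (he₀ : addOrderOf (e₀.kolyvaginClass Nat.prime_two 2) = 2 ^ 2) :
    ∃ (n : ℕ) (e : KolyvaginHeegnerData Dt β ι n), Squarefree n ∧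
      (n.primeFactors.card = n₀.primeFactors.card ∨ n.primeFactors.card = n₀.primeFactors.card + 1) ∧
      (∀ q ∈ n.primeFactors, Zhang2014.IsKolyvaginPrime (W.conductorNorm ℤ) W K 2 q ∧ L ≤ Zhang2014.kolyvaginIndex W 2 q) ∧
      addOrderOf (e.kolyvaginClass Nat.prime_two L) = 2 ^ L := by
  have hρ2 : W.HasSurjectiveModNGaloisRep 2 := by simpa using hρ 1
  obtain ⟨n, e, hn, hcard, hK', he⟩ := exists_deep_primitive_of_gross_witness_transposition' W hQ2 hcm hT hρ hK hodd h3 hHe Dt β ι hL2 hNPh hTr hn₀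
    hn₀K e₀ he₀
  have hK'' : ∀ q ∈ n.primeFactors, Zhang2014.IsKolyvaginPrime (W.conductorNorm ℤ) W K 2 q ∧ L ≤ Zhang2014.kolyvaginIndex W 2 q :=
    fun q hq ↦ ⟨(hK' q hq).1, (hK' q hq).2.1⟩
  exact ⟨n, e, hn, hcard, hK'', addOrderOf_kolyvaginClass_two_pow_eq_of_four W hK hodd h3 hHe hρ2 Dt β ι hL2 hn hK'' e he⟩

/-- **THE BOTTOM RUNG in the crux's own currency** (`P(n) ∉ 2E(K[n])` in, `P(n) ∉ 2E(K[n])` out; either witness parity): on L's frame with Q2,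
from a square-free product `n₀` of LEVEL-4 GROSS–Kolyvagin primes (Zhang–Kolyvagin, index `≥ 2`, `Frob = Frob_∞` on `K(E[4])`) carrying a datum
with `P(n₀) ∉ 2E(K[n₀])`, there is a square-free `n` with `ω(n) ∈ {ω(n₀), ω(n₀)+1}`, ALL primes Zhang–Kolyvagin of index `≥ L`, and a datum with
`P(n) ∉ 2E(K[n])` — the `r = R` clause of (P52÷) (`2^{0+1} ∤ P_d(n)` at a deep level), modulo (NPh_L^{2N}), the (V44)-socket `hTr`, Q2.
[cite: McCallumLMS1991, §5 Prop. 5.2 and its proof, p. 285] [cite: Kolyvagin1991MathAnn, Thm. 2.2] -/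
theorem exists_deep_notTwoDvd_of_gross_witness_transposition (hQ2 : KolyvaginRelationAtTwo) (hcm : ¬ W.HasCM)
    (hT : Odd W.tamagawaProduct) (hρ : ∀ m : ℕ, W.HasSurjectiveModNGaloisRep (2 ^ m : ℕ))
    (hK : IsImaginaryQuadratic K) (hodd : Odd (NumberField.discr K)) (h3 : NumberField.discr K ≠ -3)
    (hHe : SatisfiesHeegnerHypothesis (W.conductorNorm ℤ) K)
    (Dt : ModularForms.ModularParametrizationData W (W.conductorNorm ℤ)) (β : ℤ) (ι : K →+* ℂ) {L : ℕ} (hL2 : 2 ≤ L)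
    (hNPh : ∀ z : galH1Torsion (W.baseChange K) ((2 ^ L : ℕ) : ℤ),
      (∀ ρ' ∈ torsionFixing (W.baseChange K) ((2 ^ L : ℕ) : ℤ), h1Eval (W.baseChange K) ((2 ^ L : ℕ) : ℤ) z ρ' = 0) →
      (∀ w : HeightOneSpectrum (𝓞 K), ((2 * W.conductorNorm ℤ : ℕ) : 𝓞 K) ∈ w.asIdeal →
        z ∈ selmerLocalKer (W.baseChange K) (w.adicCompletion K) ((2 ^ L : ℕ) : ℤ)) → z = 0)
    (hTr : ∀ (n' : ℕ) (d' : KolyvaginHeegnerData Dt β ι n') (Z : galoisCohomology (W.torsionGaloisModule ((2 ^ 2 : ℕ) : ℤ)) 1),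
      Squarefree n' →
      (∀ q ∈ n'.primeFactors, Zhang2014.IsKolyvaginPrime (W.conductorNorm ℤ) W K 2 q ∧ 2 ≤ Zhang2014.kolyvaginIndex W 2 q ∧
        (∃ (v : HeightOneSpectrum (𝓞 ℚ)) (𝔓 : Ideal (absIntegers (𝓞 ℚ) ℚ)) (h : absoluteGaloisGroup ℚ),
          (q : 𝓞 ℚ) ∈ v.asIdeal ∧ 𝔓 ∈ v.primesAbove ∧ IsArithFrobAt (𝓞 ℚ) h 𝔓 ∧ ∃ u : geomTorsion W 2, h • u ≠ u)) →
      resTorsion W K ((2 ^ 2 : ℕ) : ℤ) Z = d'.kolyvaginClass Nat.prime_two 2 →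
      ∀ (v : HeightOneSpectrum (𝓞 ℚ)) (ℓ : ℕ), ℓ ∈ n'.primeFactors → (ℓ : 𝓞 ℚ) ∈ v.asIdeal →
        L ≤ Zhang2014.kolyvaginIndex W 2 ℓ →
        ∀ 𝔓 ∈ v.primesAbove, ∀ F : absoluteGaloisGroup ℚ, IsArithFrobAt (𝓞 ℚ) F 𝔓 →
          ∃ P₁ : geomTorsion W ((2 ^ 2 : ℕ) : ℤ), h1Eval W _ ((2 : ℕ) • Z) F = F • P₁ - P₁)
    {n₀ : ℕ} (hn₀ : Squarefree n₀)
    (hn₀K : ∀ q ∈ n₀.primeFactors, Zhang2014.IsKolyvaginPrime (W.conductorNorm ℤ) W K 2 q ∧ 2 ≤ Zhang2014.kolyvaginIndex W 2 q ∧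
      (∃ (v : HeightOneSpectrum (𝓞 ℚ)) (𝔓 : Ideal (absIntegers (𝓞 ℚ) ℚ)) (h : absoluteGaloisGroup ℚ),
        (q : 𝓞 ℚ) ∈ v.asIdeal ∧ 𝔓 ∈ v.primesAbove ∧ IsArithFrobAt (𝓞 ℚ) h 𝔓 ∧ ∃ u : geomTorsion W 2, h • u ≠ u))
    (e₀ : KolyvaginHeegnerData Dt β ι n₀)
    (he₀ : ¬ ∃ Q : (W.baseChange (ringClassField K ι n₀)).toAffine.Point, (2 : ℤ) • Q = e₀.derivedPoint) :
    ∃ (n : ℕ) (e : KolyvaginHeegnerData Dt β ι n), Squarefree n ∧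
      (n.primeFactors.card = n₀.primeFactors.card ∨ n.primeFactors.card = n₀.primeFactors.card + 1) ∧
      (∀ q ∈ n.primeFactors, Zhang2014.IsKolyvaginPrime (W.conductorNorm ℤ) W K 2 q ∧ L ≤ Zhang2014.kolyvaginIndex W 2 q) ∧
      ¬ ∃ Q : (W.baseChange (ringClassField K ι n)).toAffine.Point, (2 : ℤ) • Q = e.derivedPoint := by
  have hρ2 : W.HasSurjectiveModNGaloisRep 2 := by simpa using hρ 1
  have he₀' : addOrderOf (e₀.kolyvaginClass Nat.prime_two 2) = 2 ^ 2 :=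
    addOrderOf_kolyvaginClass_two_eq_pow_of_not_two_dvd_single W hK hodd h3 hHe hρ2 Dt β ι (M := 2) (by norm_num) hn₀
      (fun q hq ↦ ⟨(hn₀K q hq).1, (hn₀K q hq).2.1⟩) e₀ he₀
  obtain ⟨n, e, hn, hcard, hK', he⟩ := exists_deep_primitive_of_gross_witness_pow_transposition W hQ2 hcm hT hρ hK hodd h3 hHe Dt β ι hL2 hNPh hTr
    hn₀ hn₀K e₀ he₀'
  exact ⟨n, e, hn, hcard, hK',
    not_two_dvd_derivedPoint_of_addOrderOf_kolyvaginClass_two_pow W hK hodd h3 hHe hρ2 Dt β ι (by omega) hn hK' e he⟩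

end Summit.BirchSwinnertonDyer.BirchSwinnertonDyer.Theorems.GenusExact.RelaxedCount

end
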